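import Summits.AtomisticToContinuum.FouriersLaw.Theorems.BondHeatUncertaintySubdiffusiveBondHeatKernelDoobTransform
import Summits.AtomisticToContinuum.FouriersLaw.Theorems.PuiseuxTransferLedgerTwoModeBulkBlockEnergyTruncation
import Summits.AtomisticToContinuum.FouriersLaw.Theorems.PhononMeanFreePathIncoherentBoundedLeftEnergyDynkin

/-!
# Corrector identity for the two-mode profile, part 1b: Doob–Dynkin for the left block energies along the reversed kernels
(helper, `--supports` crux stmt-AtomisticToContinuum-12111 `PuiseuxTransferLedger.TwoModeBulk`, line `Sketch`)

For the `(N+1)`-site pinned chain (`ω₂ > 0`, `lam, β, γ ≥ 0`), a genuine bond `m < N`, equal bath temperatures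
`T > 0`, `ρ = e^{-H/T}` and the transition kernels `P̂_s = langevinRevKernel (N+1) T T s` of the time-reversed
(anti-friction) Langevin equation:

* `pinnedChain_leftEnergy_doobDynkin` — for `u ≥ 0` and every `y`:
  `e^{2γu} P̂_u(E_{≤m} ρ)(y) - E_{≤m}(y)ρ(y) = ∫₀ᵘ e^{2γs} P̂_s((γ(T - p_0²) + j_m) ρ)(y) ds`:
  `doob_dynkin` (`…KernelDoobTransform`: `L̂(ρf) = ρ (L(f∘Θ))∘Θ - 2γρf` on `C²_c`) for the truncations
  `E_{≤m} χ(H/R)`, the momentum flip `(L E_{≤m})∘Θ = γ(T - p_0²) + j_m` (`E_{≤m}` even, `j_m` odd; part 1a), and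
  dominated convergence `R → ∞` (all integrands carry the factor `ρ`, hence are bounded).
This is the weight-side input of the bond-resolved corrector identities (parts 2–3). No definitions; nothing here
closes the item.
-/

noncomputable section

open scoped NNReal ENNReal Topology
open MeasureTheory Filter Set

namespace Summit.AtomisticToContinuum.FouriersLaw.Theorems.TwoModeBulk.Sketch

open Literature.MathematicalPhysics.KineticTheory.HeatConduction
open Literature.MathematicalPhysics.KineticTheory Literature.Probability.Process OscillatorChain
open ProbabilityTheory
open Literature.MathematicalPhysics.KineticTheory.HeatConduction.HardTether
  (leftEnergy blockWeight bondWeight bondCurrent_add_generator_leftEnergy partialP_leftEnergy)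
open Summit.AtomisticToContinuum.FouriersLaw.Theorems.SubdiffusiveBondHeat
open Summit.AtomisticToContinuum.FouriersLaw.Theorems.BoundaryKubo.GibbsTtcf
open Summit.AtomisticToContinuum.FouriersLaw.Theorems.LinearResponseFTUR (sq_momentum_le)
open Summit.AtomisticToContinuum.FouriersLaw.Theorems.IncoherentBounded (pinnedChain_generator_leftEnergy)

variable {N : ℕ}

/-! ### Doob–Dynkin for the weight `E_{≤m}` along the reversed kernels -/

/-- **Doob–Dynkin for a left block energy along the reversed kernels.** For the `(N+1)`-site pinned chain
(`ω₂ > 0`, `lam, β, γ ≥ 0`), a genuine bond `m < N`, equal bath temperatures `T > 0`, `ρ = e^{-H/T}`, the kernels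
`P̂_s = langevinRevKernel (N+1) T T s` of the time-reversed Langevin equation, every `u ≥ 0` and every `y`:
`e^{2γu} ∫ E_{≤m} ρ dP̂_u(y,·) - E_{≤m}(y)ρ(y) = ∫₀ᵘ e^{2γs} ∫ (γ(T - p_0²) + j_m) ρ dP̂_s(y,·) ds`, i.e.
`d/ds [e^{2γs} P̂_s(ρ E_{≤m})] = e^{2γs} P̂_s(ρ · (L E_{≤m})∘Θ)` with `(L E_{≤m})∘Θ = γ(T - p_0²) + j_m`.
Proof: `doob_dynkin` for the truncations `E_{≤m} χ(H/R) ∈ C²_c`, the flip (`E_{≤m}`, `H` even, `j_m` odd), and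
dominated convergence `R → ∞` (`|E_{≤m} ρ| ≤ T`, `|(γ(T-p_0²)+j_m) ρ|` bounded, truncation error `O((1+H)²ρ/R)`).
[cite: ReyBellet2006, Lemma 4.2] -/
theorem pinnedChain_leftEnergy_doobDynkin {ω₂ lam β γ : ℝ} (hω : 0 < ω₂) (hl : 0 ≤ lam) (hβ : 0 < β)
    (hγ : 0 < γ) {m : Fin (N + 1)} (hm : m.val < N) {T : ℝ} (hT : 0 < T) {u : ℝ} (hu : 0 ≤ u)
    (y : PhaseSpace (N + 1)) :
    Real.exp (2 * γ * u) *
          ∫ x, leftEnergy (pinnedChain ω₂ lam β γ) (N + 1) m x * (pinnedChain ω₂ lam β γ).gibbsDensity (N + 1) T x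
            ∂((pinnedChain ω₂ lam β γ).langevinRevKernel (N + 1) T T u.toNNReal y) -
        leftEnergy (pinnedChain ω₂ lam β γ) (N + 1) m y * (pinnedChain ω₂ lam β γ).gibbsDensity (N + 1) T y =
      ∫ s in (0 : ℝ)..u, Real.exp (2 * γ * s) *
        ∫ x, (γ * (T - x.2 0 ^ 2) + (pinnedChain ω₂ lam β γ).bondCurrent (N + 1) m x) *
            (pinnedChain ω₂ lam β γ).gibbsDensity (N + 1) T x
          ∂((pinnedChain ω₂ lam β γ).langevinRevKernel (N + 1) T T s.toNNReal y) := by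
  -- notation and basic facts
  set P := pinnedChain ω₂ lam β γ with hPdef
  have hP : P.IsConfining := pinnedChain_isConfining hω hl hβ.le hγ.le
  have hN0 : 0 < N + 1 := Nat.succ_pos N
  have hPγ : P.γ = γ := rfl
  have hU2 : ContDiff ℝ 2 P.U := pinnedChain_contDiff_U ω₂ lam β γ
  have hV2 : ContDiff ℝ 2 P.V := pinnedChain_contDiff_V ω₂ lam β γ
  have hTγ : 0 ≤ P.γ * T := mul_nonneg hγ.le hT.le
  set κ : ℝ≥0 → Kernel (PhaseSpace (N + 1)) (PhaseSpace (N + 1)) := P.langevinRevKernel (N + 1) T T with hκ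
  haveI hprob : ∀ s z, IsProbabilityMeasure (κ s z) := fun s z =>
    isProbabilityMeasure_langevinRevKernel hP (N + 1) T T s z
  set Hm := P.hamiltonian (N + 1) with hHm
  set E : PhaseSpace (N + 1) → ℝ := leftEnergy P (N + 1) m with hEdef
  set ρ : PhaseSpace (N + 1) → ℝ := P.gibbsDensity (N + 1) T with hρdef
  have hρ : ρ = fun x => Real.exp (-Hm x / T) := rfl
  have hH2 : ContDiff ℝ 2 Hm := P.contDiff_hamiltonian hU2 hV2 (N + 1)
  have hHc : Continuous Hm := hH2.continuous
  have hU0 := hP.U_nonneg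
  have hV0 := hP.V_nonneg
  have hH0 : ∀ x, 0 ≤ Hm x := fun x => hP.hamiltonian_nonneg (N + 1) x
  have hρc : Continuous ρ := by rw [hρ]; fun_prop
  have hρ0 : ∀ x, 0 ≤ ρ x := fun x => (Real.exp_pos _).le
  have hρ1 : ∀ x, ρ x ≤ 1 := fun x => by
    rw [hρ]; dsimp only; rw [Real.exp_le_one_iff, neg_div]; exact neg_nonpos.2 (div_nonneg (hH0 x) hT.le)
  have hE2 : ContDiff ℝ 2 E := contDiff_leftEnergy P hU2 hV2 (N + 1) m
  have hEc : Continuous E := hE2.continuous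
  have hE0 : ∀ x, 0 ≤ E x := fun x => leftEnergy_nonneg P hU0 hV0 (N + 1) m x
  have hEH : ∀ x, E x ≤ Hm x := fun x => leftEnergy_le_hamiltonian P hU0 hV0 (N + 1) m x
  have hEflip : ∀ x : PhaseSpace (N + 1), E (x.1, -x.2) = E x := fun x => by
    simp only [hEdef, HardTether.leftEnergy, Pi.neg_apply, neg_sq]
  have hHflip : ∀ x : PhaseSpace (N + 1), Hm (x.1, -x.2) = Hm x := fun x =>
    P.hamiltonian_neg_momentum (N + 1) x
  -- the observable `g = E ρ`, bounded by `T`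
  set g : PhaseSpace (N + 1) → ℝ := fun x => E x * ρ x with hg
  have hgc : Continuous g := hEc.mul hρc
  have hg0 : ∀ x, 0 ≤ g x := fun x => mul_nonneg (hE0 x) (hρ0 x)
  have hgT : ∀ x, g x ≤ T := fun x => by
    calc g x ≤ Hm x * ρ x := mul_le_mul_of_nonneg_right (hEH x) (hρ0 x)
      _ ≤ T := mul_exp_neg_div_le hT (Hm x)
  have hgn : ∀ x, ‖g x‖ ≤ T := fun x => by rw [Real.norm_of_nonneg (hg0 x)]; exact hgT x
  -- the weight `W = γ(T - p_0²) + j_m` and the bound of `W ρ`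
  set W : PhaseSpace (N + 1) → ℝ := fun x => γ * (T - x.2 0 ^ 2) + P.bondCurrent (N + 1) m x with hW
  have hWc : Continuous W := by
    have := pinnedChain_continuous_bondCurrent ω₂ lam β γ (N + 1) m
    rw [hW]; fun_prop
  -- `(1 + H)² ρ ≤ C₁`
  set C₁ : ℝ := 2 * Real.exp (1 / T) / (1 / T) ^ 2 with hC₁
  have hC₁0 : 0 ≤ C₁ := by positivity
  have hsqρ : ∀ x, (1 + Hm x) ^ 2 * ρ x ≤ C₁ := fun x => by
    have h1 := one_add_sq_le_exp (hH0 x) (by positivity : (0:ℝ) < 1 / T)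
    have h2 : Real.exp (1 / T * Hm x) * ρ x = 1 := by
      rw [hρ]; dsimp only; rw [← Real.exp_add]; rw [show 1 / T * Hm x + -Hm x / T = 0 by ring]; exact Real.exp_zero
    calc (1 + Hm x) ^ 2 * ρ x ≤ (C₁ * Real.exp (1 / T * Hm x)) * ρ x := mul_le_mul_of_nonneg_right h1 (hρ0 x)
      _ = C₁ * (Real.exp (1 / T * Hm x) * ρ x) := by ring
      _ = C₁ := by rw [h2, mul_one]
  set B₀ : ℝ := γ * (T + 2) * C₁ + ((N + 1 : ℕ) : ℝ) * ((3 + β) / 2) * C₁ with hB₀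
  have hWρ : ∀ x, |W x * ρ x| ≤ B₀ := fun x => by
    have hsq : x.2 0 ^ 2 ≤ 2 * Hm x := sq_momentum_le hU0 hV0 x 0
    have hH := hH0 x
    have h1 : |γ * (T - x.2 0 ^ 2)| ≤ γ * (T + 2) * (1 + Hm x) ^ 2 := by
      rw [abs_mul, abs_of_nonneg hγ.le, mul_assoc]
      refine mul_le_mul_of_nonneg_left ?_ hγ.le
      calc |T - x.2 0 ^ 2| ≤ |T| + |x.2 0 ^ 2| := abs_sub _ _
        _ = T + x.2 0 ^ 2 := by rw [abs_of_pos hT, abs_of_nonneg (sq_nonneg _)]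
        _ ≤ (T + 2) * (1 + Hm x) ^ 2 := by nlinarith [sq_nonneg (Hm x), hT.le]
    have h2 : |P.bondCurrent (N + 1) m x| ≤ ((N + 1 : ℕ) : ℝ) * ((3 + β) / 2) * (1 + Hm x) ^ 2 := by
      have := pinnedChain_abs_bondCurrent_le hω.le hl hβ.le γ (N + 1) m x
      calc _ ≤ _ := this
        _ = _ := by ring
    have h3 : |W x| ≤ (γ * (T + 2) + ((N + 1 : ℕ) : ℝ) * ((3 + β) / 2)) * (1 + Hm x) ^ 2 := by
      calc |W x| ≤ |γ * (T - x.2 0 ^ 2)| + |P.bondCurrent (N + 1) m x| := abs_add_le _ _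
        _ ≤ _ := add_le_add h1 h2
        _ = _ := by ring
    rw [abs_mul, abs_of_nonneg (hρ0 x)]
    calc |W x| * ρ x ≤ (γ * (T + 2) + ((N + 1 : ℕ) : ℝ) * ((3 + β) / 2)) * (1 + Hm x) ^ 2 * ρ x :=
          mul_le_mul_of_nonneg_right h3 (hρ0 x)
      _ = (γ * (T + 2) + ((N + 1 : ℕ) : ℝ) * ((3 + β) / 2)) * ((1 + Hm x) ^ 2 * ρ x) := by ring
      _ ≤ (γ * (T + 2) + ((N + 1 : ℕ) : ℝ) * ((3 + β) / 2)) * C₁ :=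
          mul_le_mul_of_nonneg_left (hsqρ x) (by positivity)
      _ = B₀ := by rw [hB₀]; ring
  have hWρn : ∀ x, ‖W x * ρ x‖ ≤ B₀ := fun x => by rw [Real.norm_eq_abs]; exact hWρ x
  have hB₀0 : 0 ≤ B₀ := (abs_nonneg _).trans (hWρ y)
  -- the truncations `f_n = E χ(H/(n+1))`
  have hRpos : ∀ n : ℕ, (0:ℝ) < n + 1 := fun n => by positivity
  have hR1 : ∀ n : ℕ, (1:ℝ) ≤ n + 1 := fun n => by
    have : (0:ℝ) ≤ n := Nat.cast_nonneg n
    linarith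
  set f : ℕ → PhaseSpace (N + 1) → ℝ := fun n x => E x * smoothCutoff (Hm x / (n + 1)) with hf
  have hf2 : ∀ n, ContDiff ℝ 2 (f n) := fun n => hE2.mul ((contDiff_smoothCutoff (n := 2)).comp (hH2.div_const _))
  have hfs : ∀ n, HasCompactSupport (f n) := fun n => by
    refine HasCompactSupport.intro (hP.isCompact_setOf_hamiltonian_le (N + 1) (2 * (n + 1))) fun x hx => ?_
    simp only [mem_setOf_eq, not_le] at hx
    have h2 : 2 ≤ Hm x / (n + 1) := by rw [le_div_iff₀ (hRpos n)]; linarith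
    show E x * smoothCutoff (Hm x / (n + 1)) = 0
    rw [smoothCutoff_of_two_le h2, mul_zero]
  have hfflip : ∀ n (x : PhaseSpace (N + 1)), f n (x.1, -x.2) = f n x := fun n x => by
    show E (x.1, -x.2) * smoothCutoff (Hm (x.1, -x.2) / (n + 1)) = E x * smoothCutoff (Hm x / (n + 1))
    rw [hEflip x]
    exact congrArg _ (by rw [show Hm (x.1, -x.2) = Hm x from hHflip x])
  have hcut : ∀ x, ∀ᶠ n : ℕ in atTop, smoothCutoff (Hm x / (n + 1)) = 1 := fun x => by
    obtain ⟨n₀, hn₀⟩ := exists_nat_ge (Hm x)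
    filter_upwards [eventually_ge_atTop n₀] with n hn
    have : (n₀ : ℝ) ≤ n := by exact_mod_cast hn
    exact smoothCutoff_of_le_one (by rw [div_le_one (hRpos n)]; linarith)
  -- the truncation error
  obtain ⟨A, hA0, hA⟩ := pinnedChain_abs_generator_truncLeftEnergy_sub_le hω hl hβ.le hγ.le m hT.le
  have hLE : ∀ x, P.generator (N + 1) T T E x = γ * (T - x.2 0 ^ 2) - P.bondCurrent (N + 1) m x := fun x =>
    pinnedChain_generator_leftEnergy hω hl hβ hγ (show m.val + 1 < N + 1 by omega) T T x
  -- the flipped generator of the truncations: main part `χ_n W` plus an error `O(1/(n+1))`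
  set Lf : ℕ → PhaseSpace (N + 1) → ℝ := fun n x =>
    sdeGenerator (P.drift (N + 1)) (P.bathVecL (N + 1) T) (P.bathVecR (N + 1) T) (fun z => f n (z.1, -z.2))
      (x.1, -x.2) with hLf
  have hLf_eq : ∀ n x, Lf n x = P.generator (N + 1) T T (f n) (x.1, -x.2) := fun n x => by
    have e1 : (fun z : PhaseSpace (N + 1) => f n (z.1, -z.2)) = f n := funext (hfflip n)
    simp only [hLf]
    rw [e1, P.sdeGenerator_drift_eq_generator hN0 hTγ hTγ (hf2 n)]
  set eR : ℕ → PhaseSpace (N + 1) → ℝ := fun n x => Lf n x - smoothCutoff (Hm x / (n + 1)) * W x with heR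
  have heRb : ∀ n x, |eR n x| ≤ A / (n + 1) * (1 + Hm x) ^ 2 := fun n x => by
    have h : |P.generator (N + 1) T T (f n) (x.1, -x.2) -
        smoothCutoff (Hm (x.1, -x.2) / (n + 1)) * P.generator (N + 1) T T E (x.1, -x.2)| ≤
        A / (n + 1) * (1 + Hm (x.1, -x.2)) ^ 2 := hA (n + 1) (hR1 n) (x.1, -x.2)
    have e1 : P.generator (N + 1) T T (f n) (x.1, -x.2) -
        smoothCutoff (Hm (x.1, -x.2) / (n + 1)) * P.generator (N + 1) T T E (x.1, -x.2) = eR n x := by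
      simp only [heR, hLf_eq, hW]
      rw [hHflip x, hLE, P.bondCurrent_neg_momentum (N + 1) m x]
      simp only [Pi.neg_apply, neg_sq]
      ring
    rw [e1, hHflip x] at h
    exact h
  have hLfsplit : ∀ n x, Lf n x = smoothCutoff (Hm x / (n + 1)) * W x + eR n x := fun n x => by
    simp only [heR]; ring
  -- Doob–Dynkin for the truncations
  have hdyn : ∀ n, Real.exp (2 * γ * u) * (∫ x, ρ x * f n x ∂(κ u.toNNReal y)) - ρ y * f n y =
      ∫ s in (0:ℝ)..u, Real.exp (2 * γ * s) * ∫ x, ρ x * Lf n x ∂(κ s.toNNReal y) := by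
    intro n
    have h := doob_dynkin hP hU2 hV2 hN0 hT (hf2 n) (hfs n) u.toNNReal y
    rw [Real.coe_toNNReal _ hu, hPγ] at h
    exact h
  -- bounds: `|ρ f_n| ≤ T`, `|ρ Lf_n| ≤ B₀ + A C₁`
  have hfnb : ∀ n x, ‖ρ x * f n x‖ ≤ T := fun n x => by
    have hχ0 := smoothCutoff_nonneg (Hm x / (n + 1))
    have hχ1 := smoothCutoff_le_one (Hm x / (n + 1))
    have h0 : 0 ≤ ρ x * f n x := mul_nonneg (hρ0 x) (mul_nonneg (hE0 x) hχ0)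
    rw [Real.norm_of_nonneg h0]
    calc ρ x * f n x = g x * smoothCutoff (Hm x / (n + 1)) := by simp only [hg, hf]; ring
      _ ≤ g x := mul_le_of_le_one_right (hg0 x) hχ1
      _ ≤ T := hgT x
  have heRρ : ∀ n x, |ρ x * eR n x| ≤ A * C₁ / (n + 1) := fun n x => by
    rw [abs_mul, abs_of_nonneg (hρ0 x)]
    calc ρ x * |eR n x| ≤ ρ x * (A / (n + 1) * (1 + Hm x) ^ 2) := mul_le_mul_of_nonneg_left (heRb n x) (hρ0 x)
      _ = A / (n + 1) * ((1 + Hm x) ^ 2 * ρ x) := by ring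
      _ ≤ A / (n + 1) * C₁ := mul_le_mul_of_nonneg_left (hsqρ x) (div_nonneg hA0 (hRpos n).le)
      _ = A * C₁ / (n + 1) := by ring
  have hLfb : ∀ n x, ‖ρ x * Lf n x‖ ≤ B₀ + A * C₁ := fun n x => by
    rw [Real.norm_eq_abs, hLfsplit n x, mul_add]
    refine (abs_add_le _ _).trans (add_le_add ?_ ?_)
    · rw [show ρ x * (smoothCutoff (Hm x / (n + 1)) * W x) = smoothCutoff (Hm x / (n + 1)) * (W x * ρ x) by ring,
        abs_mul, abs_of_nonneg (smoothCutoff_nonneg _)]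
      exact (mul_le_of_le_one_left (abs_nonneg _) (smoothCutoff_le_one _)).trans (hWρ x)
    · exact (heRρ n x).trans (div_le_self (mul_nonneg hA0 hC₁0) (hR1 n))
  -- continuity of the integrands
  have hYc : Continuous (P.drift (N + 1)) := (hP.confinedDrift (N + 1)).toConfinedDrift.contDiff_drift.continuous
  have hflipc : Continuous fun z : PhaseSpace (N + 1) => ((z.1, -z.2) : PhaseSpace (N + 1)) := by fun_prop
  have hLfc : ∀ n, Continuous (Lf n) := fun n => by
    have hfΘ2 : ContDiff ℝ 2 fun z : PhaseSpace (N + 1) => f n (z.1, -z.2) := by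
      rw [show (fun z : PhaseSpace (N + 1) => f n (z.1, -z.2)) = f n from funext (hfflip n)]; exact hf2 n
    exact (continuous_sdeGenerator _ _ hYc hfΘ2).comp hflipc
  have hρLfc : ∀ n, Continuous fun x => ρ x * Lf n x := fun n => hρc.mul (hLfc n)
  have hρfc : ∀ n, Continuous fun x => ρ x * f n x := fun n => hρc.mul (hf2 n).continuous
  -- pointwise limits
  have hflim : ∀ x, Tendsto (fun n => ρ x * f n x) atTop (𝓝 (g x)) := fun x => by
    refine tendsto_const_nhds.congr' ?_
    filter_upwards [hcut x] with n hn
    show g x = ρ x * (E x * smoothCutoff (Hm x / (n + 1))); rw [hn, mul_one, hg]; ring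
  have hLflim : ∀ x, Tendsto (fun n => ρ x * Lf n x) atTop (𝓝 (W x * ρ x)) := fun x => by
    have h1 : Tendsto (fun n : ℕ => ρ x * (smoothCutoff (Hm x / (n + 1)) * W x)) atTop (𝓝 (W x * ρ x)) := by
      refine tendsto_const_nhds.congr' ?_
      filter_upwards [hcut x] with n hn
      rw [hn, one_mul, mul_comm]
    have h2 : Tendsto (fun n : ℕ => ρ x * eR n x) atTop (𝓝 0) := by
      have hCn : Tendsto (fun n : ℕ => A * C₁ / (n + 1)) atTop (𝓝 0) :=
        tendsto_const_nhds.div_atTop (tendsto_natCast_atTop_atTop.atTop_add tendsto_const_nhds)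
      exact squeeze_zero_norm (fun n => by rw [Real.norm_eq_abs]; exact heRρ n x) hCn
    have := h1.add h2
    rw [add_zero] at this
    refine this.congr fun n => ?_
    rw [hLfsplit n x]
    ring
  -- the left-hand side converges
  have hLHS : Tendsto (fun n => Real.exp (2 * γ * u) * (∫ x, ρ x * f n x ∂(κ u.toNNReal y)) - ρ y * f n y) atTop
      (𝓝 (Real.exp (2 * γ * u) * (∫ x, g x ∂(κ u.toNNReal y)) - g y)) := by
    refine Tendsto.sub (Tendsto.const_mul _ ?_) ?_
    · exact tendsto_integral_of_dominated_convergence (fun _ => T)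
        (fun n => (hρfc n).aestronglyMeasurable) (integrable_const T)
        (fun n => Eventually.of_forall (hfnb n)) (Eventually.of_forall hflim)
    · exact hflim y
  -- the right-hand side converges
  have hRHS : Tendsto (fun n => ∫ s in (0:ℝ)..u, Real.exp (2 * γ * s) * ∫ x, ρ x * Lf n x ∂(κ s.toNNReal y)) atTop
      (𝓝 (∫ s in (0:ℝ)..u, Real.exp (2 * γ * s) * ∫ x, W x * ρ x ∂(κ s.toNNReal y))) := by
    refine intervalIntegral.tendsto_integral_filter_of_dominated_convergence
      (fun _ => Real.exp (2 * γ * u) * (B₀ + A * C₁)) ?_ ?_ ?_ ?_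
    · refine Eventually.of_forall fun n => ?_
      have hc : Continuous fun s : ℝ => ∫ x, ρ x * Lf n x ∂(κ s.toNNReal y) :=
        continuous_integral_langevinRevKernel hP (N + 1) T T y (hρLfc n) (hLfb n)
      exact ((Real.continuous_exp.comp (continuous_const.mul continuous_id)).mul hc).aestronglyMeasurable
    · refine Eventually.of_forall fun n => Eventually.of_forall fun s hs => ?_
      rw [uIoc_of_le hu] at hs
      have hs0 : 0 ≤ s := hs.1.le
      have hsu : s ≤ u := hs.2
      have hint : ‖∫ x, ρ x * Lf n x ∂(κ s.toNNReal y)‖ ≤ B₀ + A * C₁ := by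
        have := norm_integral_le_of_norm_le_const (μ := κ s.toNNReal y) (Eventually.of_forall (hLfb n))
        simpa [probReal_univ] using this
      rw [norm_mul, Real.norm_of_nonneg (Real.exp_pos _).le]
      have hexp : Real.exp (2 * γ * s) ≤ Real.exp (2 * γ * u) :=
        Real.exp_le_exp.2 (mul_le_mul_of_nonneg_left hsu (by positivity))
      exact mul_le_mul hexp hint (norm_nonneg _) (Real.exp_pos _).le
    · exact intervalIntegrable_const
    · refine Eventually.of_forall fun s _ => Tendsto.const_mul _ ?_
      exact tendsto_integral_of_dominated_convergence (fun _ => B₀ + A * C₁)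
        (fun n => (hρLfc n).aestronglyMeasurable) (integrable_const _)
        (fun n => Eventually.of_forall (hLfb n)) (Eventually.of_forall hLflim)
  have hEq : (fun n => Real.exp (2 * γ * u) * (∫ x, ρ x * f n x ∂(κ u.toNNReal y)) - ρ y * f n y) =
      fun n => ∫ s in (0:ℝ)..u, Real.exp (2 * γ * s) * ∫ x, ρ x * Lf n x ∂(κ s.toNNReal y) := funext hdyn
  rw [hEq] at hLHS
  have hfinal := tendsto_nhds_unique hLHS hRHS
  -- rewrite in the stated form
  have e1 : ∫ x, g x ∂(κ u.toNNReal y) = ∫ x, E x * ρ x ∂(κ u.toNNReal y) := rfl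
  simp only [hg] at hfinal
  rw [hfinal]

/-- **Registered sub-goal `twoModeBulk_leftEnergyDoobDynkin`** of crux stmt-AtomisticToContinuum-12111 (line `Sketch`,
corrector identity (★), part 1b): `pinnedChain_leftEnergy_doobDynkin` as a closed statement (`ω₂ > 0`, `lam ≥ 0`,
`β, γ > 0`, `N + 1` sites, bond `m < N`, `T > 0`, `u ≥ 0`). [cite: ReyBellet2006, Lemma 4.2] -/
theorem twoModeBulk_leftEnergyDoobDynkin :
    ∀ ω₂ lam β γ : ℝ, 0 < ω₂ → 0 ≤ lam → 0 < β → 0 < γ → ∀ (N : ℕ) (m : Fin (N + 1)), m.val < N → ∀ T : ℝ, 0 < T → ∀ u : ℝ, 0 ≤ u → ∀ y : Literature.MathematicalPhysics.KineticTheory.HeatConduction.PhaseSpace (N + 1), Real.exp (2 * γ * u) * (∫ x, Literature.MathematicalPhysics.KineticTheory.HeatConduction.HardTether.leftEnergy (Literature.MathematicalPhysics.KineticTheory.HeatConduction.pinnedChain ω₂ lam β γ) (N + 1) m x * (Literature.MathematicalPhysics.KineticTheory.HeatConduction.pinnedChain ω₂ lam β γ).gibbsDensity (N + 1) T x ∂((Literature.MathematicalPhysics.KineticTheory.HeatConduction.pinnedChain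 ω₂ lam β γ).langevinRevKernel (N + 1) T T u.toNNReal y)) - Literature.MathematicalPhysics.KineticTheory.HeatConduction.HardTether.leftEnergy (Literature.MathematicalPhysics.KineticTheory.HeatConduction.pinnedChain ω₂ lam β γ) (N + 1) m y * (Literature.MathematicalPhysics.KineticTheory.HeatConduction.pinnedChain ω₂ lam β γ).gibbsDensity (N + 1) T y = ∫ s in (0 : ℝ)..u, Real.exp (2 * γ * s) * ∫ x, (γ * (T - (x.2 0) ^ 2) + (Literature.MathematicalPhysics.KineticTheory.HeatConduction.pinnedChain ω₂ lam β γ).bondCurrent (N + 1) m x) * (Literature.MathematicalPhysics.KineticTheory.HeatConduction.pinnedChain ω₂ lam β γ).gibbsDensity (N + 1) T x ∂((Literature.MathematicalPhysics.KineticTheory.HeatConduction.pinnedChain ω₂ lam β γ).langevinRevKernel (N + 1) T T s.toNNReal y) :=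
  fun _ _ _ _ hω hl hβ hγ _ _ hm _ hT _ hu y => pinnedChain_leftEnergy_doobDynkin hω hl hβ hγ hm hT hu y

end Summit.AtomisticToContinuum.FouriersLaw.Theorems.TwoModeBulk.Sketch

end
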